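import Summits.QuantumFields.YangMills.Theses.LuscherReduction
import Summits.QuantumFields.YangMills.Theorems.LuscherReductionTwistedTraceScalingTowerE1
import Summits.QuantumFields.YangMills.Theorems.LuscherReductionTwistedTraceScalingOfFemtoTraceLaw
import Summits.QuantumFields.YangMills.Theorems.TwistedTraceScaling.Negative.TowerE1NonUniformOfFemtoTraceLaw
import Summits.QuantumFields.YangMills.Theorems.TwistedTraceScaling.Negative.CmpTwoLoopIffUniformOfBase
import HarnessLib

/-!
# Sketch (g2) — crux-ideate #2 (round 1), card `action-domination-sandwich`: the composition CERTIFIED and CALIBRATED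
on `LuscherReduction.TwistedTraceScaling` (stmt-QuantumFields-20203)

Self-contained (the tree module `Cruxes/TwistedTraceScaling/SketchIdeator2g1.lean`, commit e3cc1e4e26f8, is not built on the farm, so the two
statement texts `TowerCauchyE1 q` and `PolyDeepTraceLaw p` are re-declared here BYTE-IDENTICALLY in a fresh namespace).  Sorry-free.

What g1 only TYPED (`AnchoredComposition q p : Prop`) is PROVED here, in a stronger currency, and its exact strength is determined:

* §2 `uniform_of_towerCauchy_polyDeep` — for exponents `0 ≤ q`, `0 ≤ p`, `p·q < 3`:
  `TowerCauchyE1 q → PolyDeepTraceLaw p → UFTL` (the `lam`-UNIFORM femto trace law, tree text = hypothesis `hU` of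
  `Tower.twistedTraceScaling_of_uniform`, witnessed with threshold `L0 := 1`).  Bookkeeping: deep in the window put `A := lam^{-q} ≥ 1`.
  ANCHOR BRANCH (`L ≥ M²`, `(M+1)·A ≤ L`): the E1 landing (`Tower.exists_tower_landing`) gives `b·M^{k+1} ≤ L < b·M^k·(M+1)`, so `b·M^k > A`; the FIRST
  tower member `L₁ = b·M^j ≥ A` has `L₁ ≤ max(b, A·M) ≤ (M+1)³·A`; its matched coupling `β₁` (`Tower.exists_matched`, same two-loop label) is
  `≥ 1/(4 lam³)` (`Tower.matched_ge`) `≥ ((M+1)³·lam^{-q})^p ≥ L₁^p` once `4·(M+1)^{3p}·lam^{3−pq} ≤ 1` — polynomial depth at the anchor, same `Λ ≤ 2lam ≤ Λ⋆`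
  (`Tower.luscherLambda_eq_of_matched`); triangle `r_L ~ r_{L₁} ~ r_𝔥(s)` at `ε/2 + ε/2`.  DIRECT BRANCH (no anchor): then `L ≤ (M+1)²·A`, and at window
  depth `β ≥ 1/(4lam³)` (`BOHandover.beta_ge_of_window`) the fine lattice is ITSELF at polynomial depth, so `PolyDeepTraceLaw` applies to `(L, β)` directly.
  Hence NO threshold in `L` and no `lam`-dependence of it: the uniform law, not just FTL.
* §3 corollaries: FTL; the CRUX BY NAME `twistedTraceScaling_of_towerCauchy_polyDeep` (via `Tower.twistedTraceScaling_of_uniform`; NO S-BASE needed);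
  `anchoredComposition_main : AnchoredComposition (11/20) 5`; the registered rev-2 stub text TOWER-E1 (via `Negative.towerE1_of_uniformFemtoTraceLaw`).
* §4 `fixedLatticeTraceLaw_of_polyDeep` — π implies the verbatim body of the registered S-BASE `Stmt.stub_fixedLatticeTraceLaw` (`Base.exists_window_of_large_beta`);
  hence `cmpTwoLoop_of_towerCauchy_polyDeep : … → TwoLattice.Stmt.stub_cmpTwoLoop` — the skeleton of record's XL stub CMP-2LOOP BY NAME (rev 3
  «two-loop calibration», sha16 1a2ae9b1ae61a9c5), through the tree's `Negative.R3.cmpTwoLoop_of_uniform_of_base` (p551232).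
* §5 STRENGTH CALIBRATION (converses): `towerCauchyE1_of_uniform : UFTL → TowerCauchyE1 q` (every `q`; witness `M := L0 + 2`),
  `polyDeep_of_uniform_of_base : UFTL → S-BASE → PolyDeepTraceLaw p` (every `p ≥ 0`; small `Λ` on a fixed lattice forces large `β`,
  `beta_large_of_luscherLambda_small`), so `towerCauchy_polyDeep_iff_uniform_base` / `towerCauchy_polyDeep_iff_cmpTwoLoop_base`:
  `TowerCauchyE1 q ∧ PolyDeepTraceLaw p ⟺ UFTL ∧ S-BASE ⟺ CMP-2LOOP ∧ S-BASE` for `0 ≤ q`, `0 ≤ p`, `pq < 3`.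
  The card RE-CUTS the open content of the line of record — comparison between two BLOCKED Wilson theories with a growing anchor (α+σ) +
  identification at polynomial depth (π), instead of fine-vs-Wilson-base comparison at calibrated coupling (CMP-2LOOP = W-REP + W-CMP(RFL) + W-FLOW) +
  identification on the fixed base (S-BASE) — it neither strengthens nor weakens it.  (The exponent bound `q > 1/2` matters only INSIDE stub α's
  cost estimate `9κ·s·b⁶/(L₁²Λ) → 0`; logically `TowerCauchyE1 q` gets weaker as `q` grows and the composition tolerates any `q < 3/p`.)

HONEST FRAMING: bookkeeping for a crux idea card on a child (TTS) of the CONDITIONAL reduction route `LuscherReduction`; femto rung R2b1 only;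
the two hypotheses `TowerCauchyE1 q` (RG side: dominated blocking + sandwich, incl. the two-loop law of the TRUE flow) and `PolyDeepTraceLaw p`
(poly-deep perturbative identification, uniform in the lattice) are OPEN and not in print; nothing here is infinite volume, a mass gap or Clay.
No definitions enter the tree from this file; no new named facts; registry untouched.
-/

set_option autoImplicit false

noncomputable section

open MeasureTheory Filter Topology Real
open Summit.QuantumFields.YangMills.Theorems.FemtoTransferGap
open Summit.QuantumFields.YangMills.Theorems.FemtoTransferGap.TraceDoor (traceRatio femtoSteps hTraceRatio)
open Summit.QuantumFields.YangMills.Theorems.FemtoTransferGap.TwoLattice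

namespace Summit.QuantumFields.YangMills.Cruxes.TwistedTraceScaling.Ideate2g2

/-! ## §0 The two statement texts (byte-identical copies of `Ideate2g1.TowerCauchyE1` / `Ideate2g1.PolyDeepTraceLaw`, commit e3cc1e4e26f8) -/

/-- **TowerCauchyE1 q** (output of stubs α DOMINATED BLOCKING + σ SANDWICH; E1 geometry of the registered line «twolattice» r2):
for every femto time `s` and precision `ε` there are a block factor `M ≥ 2` and a depth `lam0` such that, deep in the femto window,
every lattice `L ≥ M²` with its E1 landing `b·M^{k+1} ≤ L < b·M^k·(M+1)` (`b ∈ [M, M²)`) has its dyadic trace ratio at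
`T = ⌈sL/Λ⌉` within `ε` of that of EVERY regular tower member `L₁ = b·M^j`, `j ≤ k`, of size at least `lam^{−q}`, at the coarse
coupling `β₁ ≥ 1` with the same two-loop label (`invRunningCoupling β₁ L₁ = invRunningCoupling β L`).
Compared with the registered S-TOWER/TOWER-E1 the partner is a GROWING anchor, not the fixed base `b`: the base carries no law. -/
def TowerCauchyE1 (q : ℝ) : Prop :=
  ∀ s : ℝ, 0 < s → ∀ ε : ℝ, 0 < ε → ∃ M : ℕ, 2 ≤ M ∧ ∃ lam0 : ℝ, 0 < lam0 ∧ ∀ lam : ℝ, 0 < lam → lam ≤ lam0 →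
    ∀ (L : ℕ) [NeZero L], M ^ 2 ≤ L → ∀ β : ℝ, InFemtoWindow lam β L →
      ∀ (b k j : ℕ) [NeZero b], M ≤ b → b < M ^ 2 → b * M ^ (k + 1) ≤ L → L < b * M ^ k * (M + 1) → j ≤ k →
        ∀ (L₁ : ℕ) [NeZero L₁], L₁ = b * M ^ j → lam ^ (-q) ≤ (L₁ : ℝ) →
          ∀ β₁ : ℝ, 1 ≤ β₁ → invRunningCoupling β₁ L₁ = invRunningCoupling β L →
            |traceRatio L β (femtoSteps s β L) - traceRatio L₁ β₁ (femtoSteps s β₁ L₁)| ≤ ε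

/-- **PolyDeepTraceLaw p** (stub π): for every femto time `s` and precision `ε` there is `Λ⋆ > 0` such that on EVERY lattice `L`,
at every coupling of polynomial depth `β ≥ L^p` whose Lüscher parameter is genuine (`0 < invRunningCoupling β L`) and small
(`Λ(β,L) ≤ Λ⋆`), the dyadic trace ratio at `⌈sL/Λ⌉` steps is `ε`-close to Lüscher's `r_𝔥(s)`.
Uniform in `L`, but only at polynomial depth: for `p > 3` the anharmonic couplings satisfy `dimension × coupling → 0`
(single-scale, union bound beats entropy; no renormalisation group).  The line uses `p = 5` (any `p` with `3 < p < 3/q`). -/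
def PolyDeepTraceLaw (p : ℝ) : Prop :=
  ∀ s : ℝ, 0 < s → ∀ ε : ℝ, 0 < ε → ∃ Λstar : ℝ, 0 < Λstar ∧
    ∀ (L : ℕ) [NeZero L], ∀ β : ℝ, (L : ℝ) ^ p ≤ β → 0 < invRunningCoupling β L → luscherLambda β L ≤ Λstar →
      |traceRatio L β (femtoSteps s β L) - hTraceRatio s| ≤ ε

/-- **AnchoredComposition q p** (g1 text): the two statements above imply the crux. PROVED below for `0 ≤ q`, `0 < p`, `p·q < 3`. -/
def AnchoredComposition (q p : ℝ) : Prop :=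
  TowerCauchyE1 q → PolyDeepTraceLaw p → Summit.QuantumFields.YangMills.Theses.LuscherReduction.TwistedTraceScaling

/-! ## §1 Arithmetic of the anchor -/

/-- **First tower member above the anchor size.**  If `A ≤ b·M^k` then some `j ≤ k` has `A ≤ b·M^j ≤ max(b, A·M)`
(the least such `j`: either `j = 0`, or the member below it is `< A`). [folklore] -/
theorem exists_hit (A : ℝ) (b M : ℕ) : ∀ k : ℕ, A ≤ (b : ℝ) * (M : ℝ) ^ k →
    ∃ j : ℕ, j ≤ k ∧ A ≤ (b : ℝ) * (M : ℝ) ^ j ∧ (b : ℝ) * (M : ℝ) ^ j ≤ max (b : ℝ) (A * M) := by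
  intro k
  induction k with
  | zero =>
    intro h
    refine ⟨0, le_rfl, h, ?_⟩
    rw [pow_zero, mul_one]
    exact le_max_left _ _
  | succ k ih =>
    intro h
    by_cases hk : A ≤ (b : ℝ) * (M : ℝ) ^ k
    · obtain ⟨j, hj, h1, h2⟩ := ih hk
      exact ⟨j, hj.trans (Nat.le_succ k), h1, h2⟩
    · have hk' : (b : ℝ) * (M : ℝ) ^ k < A := lt_of_not_ge hk
      refine ⟨k + 1, le_rfl, h, ?_⟩
      have hM : (0 : ℝ) ≤ (M : ℝ) := Nat.cast_nonneg M
      calc (b : ℝ) * (M : ℝ) ^ (k + 1) = ((b : ℝ) * (M : ℝ) ^ k) * M := by ring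
        _ ≤ A * M := mul_le_mul_of_nonneg_right hk'.le hM
        _ ≤ max (b : ℝ) (A * M) := le_max_right _ _

/-- **Depth threshold.**  For `p·q < 3` (any real `p`) and a constant `C ≥ 1` there is `lamA > 0` with
`(C·lam^{−q})^p ≤ 1/(4 lam³)` for all `0 < lam ≤ lamA` (take `4·C^p·lamA^{3 − pq} = 1`). [folklore] -/
theorem anchor_threshold {p q : ℝ} (hpq : p * q < 3) {C : ℝ} (hC : 1 ≤ C) :
    ∃ lamA : ℝ, 0 < lamA ∧ ∀ lam : ℝ, 0 < lam → lam ≤ lamA → (C * lam ^ (-q)) ^ p ≤ 1 / (4 * lam ^ 3) := by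
  have hC0 : 0 < C := lt_of_lt_of_le one_pos hC
  have hCp : 0 < C ^ p := Real.rpow_pos_of_pos hC0 p
  set r : ℝ := 3 - p * q with hr
  have hrpos : 0 < r := by rw [hr]; linarith
  set D : ℝ := 1 / (4 * C ^ p) with hD
  have hDpos : 0 < D := by rw [hD]; positivity
  refine ⟨D ^ r⁻¹, Real.rpow_pos_of_pos hDpos _, fun lam hlam hle => ?_⟩
  -- lam^r ≤ D
  have h1 : lam ^ r ≤ D := by
    calc lam ^ r ≤ (D ^ r⁻¹) ^ r := Real.rpow_le_rpow hlam.le hle hrpos.le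
      _ = D := Real.rpow_inv_rpow hDpos.le hrpos.ne'
  -- rewrite the left-hand side
  have hlq : 0 ≤ lam ^ (-q) := Real.rpow_nonneg hlam.le _
  have hL : (C * lam ^ (-q)) ^ p = C ^ p * lam ^ (-q * p) := by
    rw [Real.mul_rpow hC0.le hlq, ← Real.rpow_mul hlam.le]
  rw [hL, le_div_iff₀ (by positivity)]
  -- C^p · lam^{-qp} · (4 lam³) = 4 C^p lam^r
  have h3 : (lam ^ 3 : ℝ) = lam ^ (3 : ℝ) := by
    rw [← Real.rpow_natCast lam 3]
    norm_num
  have hprod : lam ^ (-q * p) * lam ^ (3 : ℝ) = lam ^ r := by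
    rw [← Real.rpow_add hlam, hr]
    ring_nf
  calc C ^ p * lam ^ (-q * p) * (4 * lam ^ 3)
      = 4 * C ^ p * (lam ^ (-q * p) * lam ^ (3 : ℝ)) := by rw [h3]; ring
    _ = 4 * C ^ p * lam ^ r := by rw [hprod]
    _ ≤ 4 * C ^ p * D := mul_le_mul_of_nonneg_left h1 (by positivity)
    _ = 1 := by rw [hD]; field_simp

/-! ## §2 The composition, proved — in the UNIFORM currency

Where an anchor exists (`L ≥ M²` and `(M+1)·lam^{-q} ≤ L`) the fine lattice is compared with it (TowerCauchyE1) and the anchor is identified at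
polynomial depth (PolyDeepTraceLaw); where NO anchor exists the fine lattice is SMALL, `L ≤ (M+1)²·lam^{-q}`, and at window depth `β ≥ 1/(4 lam³)`
it is ITSELF at polynomial depth (`L^p ≤ ((M+1)³ lam^{-q})^p ≤ 1/(4lam³) ≤ β` once `p·q < 3` and `lam` is small), so PolyDeepTraceLaw applies to it
directly.  Hence the conclusion is the `lam`-UNIFORM femto trace law with threshold `L0 = 1` (stronger than FTL; the text is the hypothesis `hU` of
the tree's `Tower.twistedTraceScaling_of_uniform`, witnessed with `L0 := 1`). -/

/-- ★ **Anchored Cauchy + poly-deep identification ⇒ the `lam`-uniform femto trace law** (UFTL, tree text, witnessed with `L0 := 1`),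
for `0 ≤ q`, `0 ≤ p`, `p·q < 3`. [folklore] -/
theorem uniform_of_towerCauchy_polyDeep {q p : ℝ} (hq : 0 ≤ q) (hp : 0 ≤ p) (hpq : p * q < 3)
    (hTC : TowerCauchyE1 q) (hPD : PolyDeepTraceLaw p) :
    ∀ s : ℝ, 0 < s → ∀ ε : ℝ, 0 < ε → ∃ L0 : ℕ, ∃ lam0 : ℝ, 0 < lam0 ∧ ∀ lam : ℝ, 0 < lam → lam ≤ lam0 →
      ∀ (L : ℕ) [NeZero L], L0 ≤ L → ∀ β : ℝ, InFemtoWindow lam β L →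
        |traceRatio L β (femtoSteps s β L) - hTraceRatio s| ≤ ε := by
  intro s hs ε hε
  have hε2 : 0 < ε / 2 := by positivity
  obtain ⟨M, hM, lam0T, hlam0T, hT⟩ := hTC s hs (ε / 2) hε2
  obtain ⟨Λstar, hΛstar, hP⟩ := hPD s hs (ε / 2) hε2
  have hM1nat : 1 ≤ M := le_trans (by norm_num) hM
  have hM1 : (1 : ℝ) ≤ (M : ℝ) := by exact_mod_cast hM1nat
  have hMpos : (0 : ℝ) < (M : ℝ) := lt_of_lt_of_le one_pos hM1
  have hM1' : (1 : ℝ) ≤ (M : ℝ) + 1 := by linarith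
  have hC1 : (1 : ℝ) ≤ ((M : ℝ) + 1) ^ 3 := one_le_pow₀ hM1'
  obtain ⟨lamA, hlamA, hA⟩ := anchor_threshold hpq hC1
  refine ⟨1, min (min lam0T (Λstar / 2)) (min (1 / 2) lamA),
    lt_min (lt_min hlam0T (by positivity)) (lt_min (by norm_num) hlamA), ?_⟩
  intro lam hlam hle L _ _hL1 β hW
  have hlamT : lam ≤ lam0T := hle.trans ((min_le_left _ _).trans (min_le_left _ _))
  have hlamΛ : lam ≤ Λstar / 2 := hle.trans ((min_le_left _ _).trans (min_le_right _ _))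
  have hlamhalf : lam ≤ 1 / 2 := hle.trans ((min_le_right _ _).trans (min_le_left _ _))
  have hlamA' : lam ≤ lamA := hle.trans ((min_le_right _ _).trans (min_le_right _ _))
  have hlam1 : lam ≤ 1 := by linarith
  -- the anchor size A := lam^{-q} ≥ 1
  obtain ⟨A, hAdef⟩ : ∃ A : ℝ, A = lam ^ (-q) := ⟨_, rfl⟩
  have hA1 : 1 ≤ A := by
    rw [hAdef]
    exact Real.one_le_rpow_of_pos_of_le_one_of_nonpos hlam hlam1 (by linarith)
  have hApos : 0 < A := lt_of_lt_of_le one_pos hA1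
  -- facts about the fine lattice in its window
  have hβge : 1 / (4 * lam ^ 3) ≤ β := BOHandover.beta_ge_of_window hlam hW
  have hinvL : 0 < invRunningCoupling β L :=
    BOHandover.invRunningCoupling_pos_of_luscherLambda_pos (luscherLambda_pos_of_window hlam hW)
  have hΛL : luscherLambda β L ≤ Λstar := by linarith [hW.2.2]
  -- anything of size ≤ (M+1)³·A at coupling ≥ 1/(4 lam³) is at polynomial depth
  have hdeep : ∀ x : ℝ, 0 ≤ x → x ≤ ((M : ℝ) + 1) ^ 3 * A → ∀ β' : ℝ, 1 / (4 * lam ^ 3) ≤ β' → x ^ p ≤ β' := by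
    intro x hx hxle β' hβ'
    calc x ^ p ≤ (((M : ℝ) + 1) ^ 3 * A) ^ p := Real.rpow_le_rpow hx hxle hp
      _ = (((M : ℝ) + 1) ^ 3 * lam ^ (-q)) ^ p := by rw [hAdef]
      _ ≤ 1 / (4 * lam ^ 3) := hA lam hlam hlamA'
      _ ≤ β' := hβ'
  by_cases hcase : M ^ 2 ≤ L ∧ ((M : ℝ) + 1) * A ≤ (L : ℝ)
  · -- ANCHOR BRANCH: E1 landing, first tower member of size ≥ A, matched coupling, poly-deep identification, triangle
    obtain ⟨hLM, hLA⟩ := hcase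
    obtain ⟨k, b, hMb, hbM, hkL, hLk⟩ := Tower.exists_tower_landing hM hLM
    have hbpos : 0 < b := lt_of_lt_of_le (by omega) hMb
    haveI : NeZero b := ⟨hbpos.ne'⟩
    have hAk : A ≤ (b : ℝ) * (M : ℝ) ^ k := by
      have h1 : (L : ℝ) < (b : ℝ) * (M : ℝ) ^ k * ((M : ℝ) + 1) := by exact_mod_cast hLk
      have h2 : A * ((M : ℝ) + 1) < (b : ℝ) * (M : ℝ) ^ k * ((M : ℝ) + 1) := by
        calc A * ((M : ℝ) + 1) = ((M : ℝ) + 1) * A := mul_comm _ _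
          _ ≤ (L : ℝ) := hLA
          _ < _ := h1
      exact (lt_of_mul_lt_mul_right h2 (by positivity)).le
    obtain ⟨j, hjk, hAj, hjle⟩ := exists_hit A b M k hAk
    obtain ⟨L₁, hL₁def⟩ : ∃ L₁ : ℕ, L₁ = b * M ^ j := ⟨_, rfl⟩
    have hL₁cast : (L₁ : ℝ) = (b : ℝ) * (M : ℝ) ^ j := by rw [hL₁def]; push_cast; ring
    have hL₁pos : 0 < L₁ := by
      rw [hL₁def]
      exact Nat.mul_pos hbpos (pow_pos (lt_of_lt_of_le (by norm_num) hM) j)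
    haveI : NeZero L₁ := ⟨hL₁pos.ne'⟩
    have hL₁ge : lam ^ (-q) ≤ (L₁ : ℝ) := by rw [hL₁cast, ← hAdef]; exact hAj
    have hL₁le : (L₁ : ℝ) ≤ ((M : ℝ) + 1) ^ 3 * A := by
      rw [hL₁cast]
      refine hjle.trans (max_le ?_ ?_)
      · have hb2 : (b : ℝ) ≤ (M : ℝ) ^ 2 := by exact_mod_cast hbM.le
        calc (b : ℝ) ≤ (M : ℝ) ^ 2 := hb2
          _ ≤ ((M : ℝ) + 1) ^ 2 := pow_le_pow_left₀ hMpos.le (by linarith) 2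
          _ ≤ ((M : ℝ) + 1) ^ 3 := pow_le_pow_right₀ hM1' (by norm_num)
          _ = ((M : ℝ) + 1) ^ 3 * 1 := (mul_one _).symm
          _ ≤ ((M : ℝ) + 1) ^ 3 * A := mul_le_mul_of_nonneg_left hA1 (by positivity)
      · calc A * (M : ℝ) ≤ A * ((M : ℝ) + 1) ^ 3 :=
            mul_le_mul_of_nonneg_left ((by linarith : (M : ℝ) ≤ (M : ℝ) + 1).trans (le_self_pow₀ hM1' (by norm_num))) hApos.le
          _ = ((M : ℝ) + 1) ^ 3 * A := mul_comm _ _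
    obtain ⟨β₁, hβ₁1, hmatch⟩ := Tower.exists_matched L₁ (v := invRunningCoupling β L)
      (Tower.one_le_invRunningCoupling_of_window hlam hlamhalf hW)
    have hβ₁ge : 1 / (4 * lam ^ 3) ≤ β₁ := Tower.matched_ge hlam hW hβ₁1 hmatch
    have hdepth : (L₁ : ℝ) ^ p ≤ β₁ := hdeep L₁ (by positivity) hL₁le β₁ hβ₁ge
    have hinv : 0 < invRunningCoupling β₁ L₁ := by rw [hmatch]; exact hinvL
    have hΛle : luscherLambda β₁ L₁ ≤ Λstar := by rw [Tower.luscherLambda_eq_of_matched hmatch]; exact hΛL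
    have hanchor : |traceRatio L₁ β₁ (femtoSteps s β₁ L₁) - hTraceRatio s| ≤ ε / 2 := hP L₁ β₁ hdepth hinv hΛle
    have hpair : |traceRatio L β (femtoSteps s β L) - traceRatio L₁ β₁ (femtoSteps s β₁ L₁)| ≤ ε / 2 :=
      hT lam hlam hlamT L hLM β hW b k j hMb hbM hkL hLk hjk L₁ hL₁def hL₁ge β₁ hβ₁1 hmatch
    calc |traceRatio L β (femtoSteps s β L) - hTraceRatio s|
        = |(traceRatio L β (femtoSteps s β L) - traceRatio L₁ β₁ (femtoSteps s β₁ L₁)) +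
            (traceRatio L₁ β₁ (femtoSteps s β₁ L₁) - hTraceRatio s)| := by congr 1; ring
      _ ≤ |traceRatio L β (femtoSteps s β L) - traceRatio L₁ β₁ (femtoSteps s β₁ L₁)| +
            |traceRatio L₁ β₁ (femtoSteps s β₁ L₁) - hTraceRatio s| := abs_add_le _ _
      _ ≤ ε := by linarith
  · -- DIRECT BRANCH: no anchor ⇒ the fine lattice is small, `L ≤ (M+1)³·A`, hence itself at polynomial depth
    have hLle : (L : ℝ) ≤ ((M : ℝ) + 1) ^ 3 * A := by
      rcases not_and_or.mp hcase with h | h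
      · have h' : (L : ℝ) < (M : ℝ) ^ 2 := by exact_mod_cast (not_le.mp h)
        calc (L : ℝ) ≤ (M : ℝ) ^ 2 := h'.le
          _ ≤ ((M : ℝ) + 1) ^ 2 := pow_le_pow_left₀ hMpos.le (by linarith) 2
          _ ≤ ((M : ℝ) + 1) ^ 3 := pow_le_pow_right₀ hM1' (by norm_num)
          _ = ((M : ℝ) + 1) ^ 3 * 1 := (mul_one _).symm
          _ ≤ ((M : ℝ) + 1) ^ 3 * A := mul_le_mul_of_nonneg_left hA1 (by positivity)
      · have h' : (L : ℝ) < ((M : ℝ) + 1) * A := not_le.mp h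
        calc (L : ℝ) ≤ ((M : ℝ) + 1) * A := h'.le
          _ ≤ ((M : ℝ) + 1) ^ 3 * A := mul_le_mul_of_nonneg_right (le_self_pow₀ hM1' (by norm_num)) hApos.le
    have hdepthL : (L : ℝ) ^ p ≤ β := hdeep L (by positivity) hLle β hβge
    exact (hP L β hdepthL hinvL hΛL).trans (by linarith)

/-! ## §3 Corollaries: FTL, the crux BY NAME, the registered stub texts TOWER-E1 (rev 2) and CMP-2LOOP (rev 3, with S-BASE from π) -/

/-- The (non-uniform) femto trace law FTL from the two stubs (tree `Tower.femtoTraceLaw_of_uniform`). [folklore] -/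
theorem femtoTraceLaw_of_towerCauchy_polyDeep {q p : ℝ} (hq : 0 ≤ q) (hp : 0 ≤ p) (hpq : p * q < 3)
    (hTC : TowerCauchyE1 q) (hPD : PolyDeepTraceLaw p) :
    ∀ s : ℝ, 0 < s → ∀ ε : ℝ, 0 < ε → ∃ lam0 : ℝ, 0 < lam0 ∧ ∀ lam : ℝ, 0 < lam → lam ≤ lam0 →
      ∃ L0 : ℕ, ∀ (L : ℕ) [NeZero L], L0 ≤ L → ∀ β : ℝ, InFemtoWindow lam β L →
        |traceRatio L β (femtoSteps s β L) - hTraceRatio s| ≤ ε :=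
  Tower.femtoTraceLaw_of_uniform (uniform_of_towerCauchy_polyDeep hq hp hpq hTC hPD)

/-- ★ **The crux BY NAME from the card's two trace-level stubs** (no S-BASE): `TowerCauchyE1 q → PolyDeepTraceLaw p → TwistedTraceScaling`
for `0 ≤ q`, `0 ≤ p`, `p·q < 3`, through the tree's `Tower.twistedTraceScaling_of_uniform`. [folklore] -/
theorem twistedTraceScaling_of_towerCauchy_polyDeep {q p : ℝ} (hq : 0 ≤ q) (hp : 0 ≤ p) (hpq : p * q < 3)
    (hTC : TowerCauchyE1 q) (hPD : PolyDeepTraceLaw p) :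
    Summit.QuantumFields.YangMills.Theses.LuscherReduction.TwistedTraceScaling :=
  Tower.twistedTraceScaling_of_uniform (uniform_of_towerCauchy_polyDeep hq hp hpq hTC hPD)

/-- `AnchoredComposition q p` holds for every admissible exponent pair. [folklore] -/
theorem anchoredComposition_of_exponents {q p : ℝ} (hq : 0 ≤ q) (hp : 0 ≤ p) (hpq : p * q < 3) :
    AnchoredComposition q p :=
  fun hTC hPD => twistedTraceScaling_of_towerCauchy_polyDeep hq hp hpq hTC hPD

/-- The card's exponents `q = 11/20`, `p = 5` (`pq = 11/4 < 3`). [folklore] -/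
theorem anchoredComposition_main : AnchoredComposition (11 / 20) 5 :=
  anchoredComposition_of_exponents (by norm_num) (by norm_num) (by norm_num)

/-- The registered rev-2 stub text TOWER-E1 (verbatim, as concluded by the tree's `Negative.towerE1_of_uniformFemtoTraceLaw`) from the two stubs. [folklore] -/
theorem towerE1_of_towerCauchy_polyDeep {q p : ℝ} (hq : 0 ≤ q) (hp : 0 ≤ p) (hpq : p * q < 3)
    (hTC : TowerCauchyE1 q) (hPD : PolyDeepTraceLaw p) :
    ∀ s : ℝ, 0 < s → ∀ ε : ℝ, 0 < ε → ∃ M : ℕ, 2 ≤ M ∧ ∃ lam0 : ℝ, 0 < lam0 ∧ ∀ lam : ℝ, 0 < lam → lam ≤ lam0 →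
      ∀ (L : ℕ) [NeZero L], M ^ 2 ≤ L → ∀ β : ℝ, InFemtoWindow lam β L →
        ∀ (b k : ℕ) [NeZero b], M ≤ b → b < M ^ 2 → b * M ^ (k + 1) ≤ L → L < b * M ^ k * (M + 1) →
          ∀ β₁ : ℝ, 1 ≤ β₁ → invRunningCoupling β₁ b = invRunningCoupling β L →
            |traceRatio L β (femtoSteps s β L) - traceRatio b β₁ (femtoSteps s β₁ b)| ≤ ε :=
  Summit.QuantumFields.YangMills.Theorems.TwistedTraceScaling.Negative.towerE1_of_uniformFemtoTraceLaw
    (uniform_of_towerCauchy_polyDeep hq hp hpq hTC hPD)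

/-! ## §4 π subsumes S-BASE; the skeleton of record's XL stub from the card's stubs -/

/-- **PolyDeepTraceLaw ⇒ S-BASE** (conclusion = the verbatim body of the registered stub `Stmt.stub_fixedLatticeTraceLaw`, skeleton rev 3):
on a fixed lattice, `β → ∞` drives `(L₁, β)` into ever deeper femto windows (`Base.exists_window_of_large_beta`), where `Λ ≤ 2 lam ≤ Λ⋆`,
the label is genuine, and `β ≥ L₁^p` eventually. [folklore] -/
theorem fixedLatticeTraceLaw_of_polyDeep {p : ℝ} (hPD : PolyDeepTraceLaw p) :
    ∀ (L1 : ℕ) [NeZero L1] (s : ℝ), 0 < s → ∀ ε : ℝ, 0 < ε → ∃ β1 : ℝ, ∀ β : ℝ, β1 ≤ β →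
      |traceRatio L1 β (femtoSteps s β L1) - hTraceRatio s| ≤ ε := by
  intro L1 _ s hs ε hε
  obtain ⟨Λstar, hΛstar, hP⟩ := hPD s hs ε hε
  obtain ⟨β1, hβ1⟩ := Base.exists_window_of_large_beta L1 (lam0 := Λstar / 2) (by positivity)
  refine ⟨max β1 ((L1 : ℝ) ^ p), fun β hβ => ?_⟩
  obtain ⟨lam, hlam, hlamle, hW⟩ := hβ1 β ((le_max_left _ _).trans hβ)
  have hinv : 0 < invRunningCoupling β L1 :=
    BOHandover.invRunningCoupling_pos_of_luscherLambda_pos (luscherLambda_pos_of_window hlam hW)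
  have hΛle : luscherLambda β L1 ≤ Λstar := by linarith [hW.2.2]
  exact hP L1 β ((le_max_right _ _).trans hβ) hinv hΛle

/-- ★ **The registered XL stub CMP-2LOOP BY NAME** (`TwoLattice.Stmt.stub_cmpTwoLoop`, skeleton rev 3 «two-loop calibration», sha16 1a2ae9b1ae61a9c5)
from the card's two stubs: UFTL from §2, S-BASE from π, then the tree's `Negative.R3.cmpTwoLoop_of_uniform_of_base` (p551232).
So a prover holding α+σ (⇒ `TowerCauchyE1 q`) and π closes the skeleton of record's open stub, for every lawful calibrator. [folklore] -/
theorem cmpTwoLoop_of_towerCauchy_polyDeep {q p : ℝ} (hq : 0 ≤ q) (hp : 0 ≤ p) (hpq : p * q < 3)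
    (hTC : TowerCauchyE1 q) (hPD : PolyDeepTraceLaw p) : Stmt.stub_cmpTwoLoop :=
  Summit.QuantumFields.YangMills.Theorems.TwistedTraceScaling.Negative.R3.cmpTwoLoop_of_uniform_of_base
    (uniform_of_towerCauchy_polyDeep hq hp hpq hTC hPD) (fixedLatticeTraceLaw_of_polyDeep hPD)

/-! ## §5 Strength calibration (converses): the card's pair is EXACTLY as strong as the skeleton's pair

`UFTL ⇒ TowerCauchyE1 q` for every `q` (the block factor `M` is chosen after `(s, ε)`: `M := L0 + 2` puts every tower member above the
UFTL threshold — the same witness as the tree's `Negative.towerE1_of_uniformFemtoTraceLaw`), and `UFTL ∧ S-BASE ⇒ PolyDeepTraceLaw p` for every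
`p ≥ 0` (a poly-deep coupling with small `Λ` lies in the window of depth `Λ/2`; the finitely many lattices below the UFTL threshold are handled by
S-BASE, since small `Λ` on a fixed lattice forces large `β`).  Hence, for admissible exponents,
`TowerCauchyE1 q ∧ PolyDeepTraceLaw p ⟺ UFTL ∧ S-BASE ⟺ CMP-2LOOP ∧ S-BASE` — the card RE-CUTS the open content of the line of record
(comparison between two BLOCKED theories with a growing anchor + identification at polynomial depth, instead of fine-vs-Wilson-base comparison at
calibrated coupling + identification on the fixed base); it neither strengthens nor weakens it. -/

/-- **UFTL ⇒ TowerCauchyE1 q** (every real `q`), witness `M := L0 + 2`. [folklore] -/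
theorem towerCauchyE1_of_uniform (q : ℝ)
    (hU : ∀ s : ℝ, 0 < s → ∀ ε : ℝ, 0 < ε → ∃ L0 : ℕ, ∃ lam0 : ℝ, 0 < lam0 ∧ ∀ lam : ℝ, 0 < lam → lam ≤ lam0 →
      ∀ (L : ℕ) [NeZero L], L0 ≤ L → ∀ β : ℝ, InFemtoWindow lam β L →
        |traceRatio L β (femtoSteps s β L) - hTraceRatio s| ≤ ε) :
    TowerCauchyE1 q := by
  intro s hs ε hε
  obtain ⟨L0, lam0, hlam0, h⟩ := hU s hs (ε / 2) (by positivity)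
  refine ⟨L0 + 2, by omega, lam0, hlam0, fun lam hlam hle => ?_⟩
  intro L _ hL β hW b k j _ hMb _ _ _ _ L₁ _ hL₁def _ β₁ hβ₁ hmatch
  have hW₁ : InFemtoWindow lam β₁ L₁ := Tower.window_of_matched hW hβ₁ hmatch
  have hML₁ : L0 + 2 ≤ L₁ := by
    rw [hL₁def]
    calc L0 + 2 ≤ b := hMb
      _ = b * 1 := (mul_one b).symm
      _ ≤ b * (L0 + 2) ^ j := Nat.mul_le_mul_left b (Nat.one_le_pow j (L0 + 2) (by omega))
  have h1 := h lam hlam hle L (by nlinarith) β hW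
  have h2 := h lam hlam hle L₁ (by omega) β₁ hW₁
  rw [abs_le] at h1 h2 ⊢
  constructor <;> linarith

/-- On a fixed lattice, a small genuine Lüscher parameter forces a large coupling: given `β1` there is `Λ_L > 0` with
`1 ≤ β → 0 < invRunningCoupling β L → Λ(β,L) ≤ Λ_L → β1 ≤ β` (window of depth `Λ/2` and `BOHandover.beta_ge_of_window`). [folklore] -/
theorem beta_large_of_luscherLambda_small (L : ℕ) [NeZero L] (β1 : ℝ) :
    ∃ ΛL : ℝ, 0 < ΛL ∧ ∀ β : ℝ, 1 ≤ β → 0 < invRunningCoupling β L → luscherLambda β L ≤ ΛL → β1 ≤ β := by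
  have hVpos : 0 < max β1 1 := lt_of_lt_of_le one_pos (le_max_right _ _)
  refine ⟨min 1 (1 / max β1 1), lt_min one_pos (by positivity), fun β hβ1 hinv hle => ?_⟩
  have hΛpos : 0 < luscherLambda β L := Track.luscherLambda_pos_of_inv_pos hinv
  have hWL : InFemtoWindow (luscherLambda β L / 2) β L := ⟨hβ1, by linarith, by linarith⟩
  have hβge : 1 / (4 * (luscherLambda β L / 2) ^ 3) ≤ β := BOHandover.beta_ge_of_window (by positivity) hWL
  have hle1 : luscherLambda β L ≤ 1 := hle.trans (min_le_left _ _)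
  have hleV : luscherLambda β L ≤ 1 / max β1 1 := hle.trans (min_le_right _ _)
  -- 4 (Λ/2)^3 = Λ³/2 ≤ Λ/2 ≤ 1/(2 max β1 1)
  have hcube : luscherLambda β L ^ 3 ≤ luscherLambda β L := by
    calc luscherLambda β L ^ 3 ≤ luscherLambda β L ^ 1 := pow_le_pow_of_le_one hΛpos.le hle1 (by norm_num)
      _ = luscherLambda β L := pow_one _
  have hden : 4 * (luscherLambda β L / 2) ^ 3 ≤ 1 / (2 * max β1 1) := by
    have : 4 * (luscherLambda β L / 2) ^ 3 = luscherLambda β L ^ 3 / 2 := by ring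
    rw [this, div_le_div_iff₀ (by norm_num) (by positivity)]
    calc luscherLambda β L ^ 3 * (2 * max β1 1) ≤ luscherLambda β L * (2 * max β1 1) :=
          mul_le_mul_of_nonneg_right hcube (by positivity)
      _ ≤ (1 / max β1 1) * (2 * max β1 1) := mul_le_mul_of_nonneg_right hleV (by positivity)
      _ = 1 * 2 := by field_simp
  have hkey : 2 * max β1 1 ≤ β := by
    calc 2 * max β1 1 = 1 / (1 / (2 * max β1 1)) := (one_div_one_div _).symm
      _ ≤ 1 / (4 * (luscherLambda β L / 2) ^ 3) := one_div_le_one_div_of_le (by positivity) hden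
      _ ≤ β := hβge
  linarith [le_max_left β1 1, le_max_right β1 1]

/-- **UFTL ∧ S-BASE ⇒ PolyDeepTraceLaw p** (every `p ≥ 0`). [folklore] -/
theorem polyDeep_of_uniform_of_base {p : ℝ} (hp : 0 ≤ p)
    (hU : ∀ s : ℝ, 0 < s → ∀ ε : ℝ, 0 < ε → ∃ L0 : ℕ, ∃ lam0 : ℝ, 0 < lam0 ∧ ∀ lam : ℝ, 0 < lam → lam ≤ lam0 →
      ∀ (L : ℕ) [NeZero L], L0 ≤ L → ∀ β : ℝ, InFemtoWindow lam β L →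
        |traceRatio L β (femtoSteps s β L) - hTraceRatio s| ≤ ε)
    (hBASE : ∀ (L1 : ℕ) [NeZero L1] (s : ℝ), 0 < s → ∀ ε : ℝ, 0 < ε → ∃ β1 : ℝ, ∀ β : ℝ, β1 ≤ β →
      |traceRatio L1 β (femtoSteps s β L1) - hTraceRatio s| ≤ ε) :
    PolyDeepTraceLaw p := by
  intro s hs ε hε
  obtain ⟨L0, lam0, hlam0, hUL⟩ := hU s hs ε hε
  -- poly-deep couplings are ≥ 1
  have hone : ∀ (L : ℕ) [NeZero L] (β : ℝ), (L : ℝ) ^ p ≤ β → 1 ≤ β := by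
    intro L _ β hβ
    have hL1 : (1 : ℝ) ≤ (L : ℝ) := by exact_mod_cast Nat.one_le_iff_ne_zero.mpr (NeZero.ne L)
    exact (Real.one_le_rpow hL1 hp).trans hβ
  -- the finitely many lattices `L ≤ L0`: a common `Λ`-threshold from S-BASE, by induction
  have hsmall : ∀ n : ℕ, ∃ Λn : ℝ, 0 < Λn ∧ ∀ (L : ℕ) [NeZero L], L ≤ n → ∀ β : ℝ, 1 ≤ β →
      0 < invRunningCoupling β L → luscherLambda β L ≤ Λn → |traceRatio L β (femtoSteps s β L) - hTraceRatio s| ≤ ε := by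
    intro n
    induction n with
    | zero =>
      refine ⟨1, one_pos, fun L _ hL β _ _ _ => ?_⟩
      exact absurd (Nat.le_zero.mp hL) (NeZero.ne L)
    | succ n ih =>
      obtain ⟨Λn, hΛn, hn⟩ := ih
      obtain ⟨β1, hB⟩ := hBASE (n + 1) s hs ε hε
      obtain ⟨ΛL, hΛL, hforce⟩ := beta_large_of_luscherLambda_small (n + 1) β1
      refine ⟨min Λn ΛL, lt_min hΛn hΛL, fun L _ hL β hβ1 hinv hle => ?_⟩
      rcases Nat.lt_or_eq_of_le hL with hlt | heq
      · exact hn L (Nat.lt_succ_iff.mp hlt) β hβ1 hinv (hle.trans (min_le_left _ _))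
      · subst heq
        exact hB β (hforce β hβ1 hinv (hle.trans (min_le_right _ _)))
  obtain ⟨Λ0, hΛ0, h0⟩ := hsmall L0
  refine ⟨min (2 * lam0) Λ0, lt_min (by positivity) hΛ0, fun L _ β hdepth hinv hle => ?_⟩
  have hβ1 : 1 ≤ β := hone L β hdepth
  rcases le_or_gt L L0 with hL | hL
  · exact h0 L hL β hβ1 hinv (hle.trans (min_le_right _ _))
  · -- above the UFTL threshold: `(L, β)` is in the window of depth `Λ/2 ≤ lam0`
    have hΛpos : 0 < luscherLambda β L := Track.luscherLambda_pos_of_inv_pos hinv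
    have hW : InFemtoWindow (luscherLambda β L / 2) β L := ⟨hβ1, by linarith, by linarith⟩
    exact hUL (luscherLambda β L / 2) (by linarith) (by linarith [hle.trans (min_le_left _ _)]) L hL.le β hW

/-- ★ **Strength calibration.**  For admissible exponents the card's pair of stubs is EQUIVALENT to `UFTL ∧ S-BASE`. [folklore] -/
theorem towerCauchy_polyDeep_iff_uniform_base {q p : ℝ} (hq : 0 ≤ q) (hp : 0 ≤ p) (hpq : p * q < 3) :
    (TowerCauchyE1 q ∧ PolyDeepTraceLaw p) ↔
    ((∀ s : ℝ, 0 < s → ∀ ε : ℝ, 0 < ε → ∃ L0 : ℕ, ∃ lam0 : ℝ, 0 < lam0 ∧ ∀ lam : ℝ, 0 < lam → lam ≤ lam0 →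
      ∀ (L : ℕ) [NeZero L], L0 ≤ L → ∀ β : ℝ, InFemtoWindow lam β L →
        |traceRatio L β (femtoSteps s β L) - hTraceRatio s| ≤ ε) ∧
     (∀ (L1 : ℕ) [NeZero L1] (s : ℝ), 0 < s → ∀ ε : ℝ, 0 < ε → ∃ β1 : ℝ, ∀ β : ℝ, β1 ≤ β →
      |traceRatio L1 β (femtoSteps s β L1) - hTraceRatio s| ≤ ε)) :=
  ⟨fun h => ⟨uniform_of_towerCauchy_polyDeep hq hp hpq h.1 h.2, fixedLatticeTraceLaw_of_polyDeep h.2⟩,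
    fun h => ⟨towerCauchyE1_of_uniform q h.1, polyDeep_of_uniform_of_base hp h.1 h.2⟩⟩

/-- ★ **… and to the skeleton of record's pair `CMP-2LOOP ∧ S-BASE`** (`TwoLattice.Stmt.stub_cmpTwoLoop` BY NAME and the verbatim body of the
registered `Stmt.stub_fixedLatticeTraceLaw`; tree `Negative.R3.cmpTwoLoop_of_uniform_of_base` / `uniform_of_cmpTwoLoop_of_base`). [folklore] -/
theorem towerCauchy_polyDeep_iff_cmpTwoLoop_base {q p : ℝ} (hq : 0 ≤ q) (hp : 0 ≤ p) (hpq : p * q < 3) :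
    (TowerCauchyE1 q ∧ PolyDeepTraceLaw p) ↔
    (Stmt.stub_cmpTwoLoop ∧
     (∀ (L1 : ℕ) [NeZero L1] (s : ℝ), 0 < s → ∀ ε : ℝ, 0 < ε → ∃ β1 : ℝ, ∀ β : ℝ, β1 ≤ β →
      |traceRatio L1 β (femtoSteps s β L1) - hTraceRatio s| ≤ ε)) := by
  rw [towerCauchy_polyDeep_iff_uniform_base hq hp hpq]
  constructor
  · rintro ⟨hU, hB⟩
    exact ⟨Summit.QuantumFields.YangMills.Theorems.TwistedTraceScaling.Negative.R3.cmpTwoLoop_of_uniform_of_base hU hB, hB⟩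
  · rintro ⟨hC, hB⟩
    exact ⟨Summit.QuantumFields.YangMills.Theorems.TwistedTraceScaling.Negative.R3.uniform_of_cmpTwoLoop_of_base hC hB, hB⟩

end Summit.QuantumFields.YangMills.Cruxes.TwistedTraceScaling.Ideate2g2

end
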